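import Literature.Analysis.Asymptotics.LogPowerScaleFilter

/-!
# Route ValuedFieldSpecialisation, crux `CTConstruction` — stub `stub_divergentMonomialsFilter`

Problem `KontsevichZagierPeriods`, route `ValuedFieldSpecialisation`, crux
stmt-KontsevichZagierPeriods-3495 (`CTConstruction`), line `registered`: the log-power scale
lemma ALONG A SUB-FILTER. If a finite real combination `∑ i, w i * s ^ (a i) * (log s) ^ (b i)`
of monomials divergent at `0⁺` (`a i < 0`, or `a i = 0` and `0 < b i`) tends to a finite limit
`d` along a non-trivial filter `l ≤ 𝓝[>] 0` (e.g. `𝓝[>] 0 ⊓ 𝓟 A` for a set `A` of full measure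
near `0`, which is all that fibred relations control), then `d = 0`.

This is VERBATIM the `Fintype`-indexed Literature theorem
`Literature.Analysis.Asymptotics.eq_zero_of_tendsto_fintypeSum_divergentMonomials_of_le`
(`Literature/Analysis/Asymptotics/LogPowerScaleFilter.lean`: the dominant-monomial induction of
`eq_zero_of_tendsto_sum_divergentMonomials` run along `l`, every comparison limit at `0⁺`
restricted by `Filter.Tendsto.mono_left`, uniqueness of limits from `l.NeBot`), with the
instance argument `l.NeBot` made an explicit hypothesis as the crux skeleton states it.

Sources: T. Kaiser, Proc. LMS 116 (2017), Lemma 4.6 / Prop. 4.7 (the dominant-exponent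
argument); G. Comte, J.-M. Lion, J.-P. Rolin, Illinois J. Math. 44 (2000), Thm. 1 (the scale).
-/

namespace Summit.KontsevichZagierPeriods.ValuedFieldSpecialisation

/-- Crux `CTConstruction` (stmt-KontsevichZagierPeriods-3495), stub 3b (LOG-POWER SCALE ALONG A
SUB-FILTER): if a finite real combination of DIVERGENT monomials `s ^ a * (log s) ^ b`
(`a < 0`, or `a = 0 < b`) tends to a finite limit `d` along a non-trivial filter `l ≤ 𝓝[>] 0`,
then `d = 0`. One line from
`Literature.Analysis.Asymptotics.eq_zero_of_tendsto_fintypeSum_divergentMonomials_of_le`.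
[Kaiser 2017, Prop. 4.7] [folklore] -/
theorem stub_divergentMonomialsFilter : ∀ (ι : Type) [Fintype ι] (a : ι → ℝ) (b : ι → ℕ) (w : ι → ℝ) (d : ℝ) (l : Filter ℝ), l.NeBot → l ≤ nhdsWithin (0 : ℝ) (Set.Ioi 0) → (∀ i, a i < 0 ∨ (a i = 0 ∧ 0 < b i)) → Filter.Tendsto (fun s : ℝ => ∑ i, w i * s ^ (a i) * Real.log s ^ (b i)) l (nhds d) → d = 0 :=
  fun _ _ _ _ _ _ _ hl hle hab h =>
    haveI := hl
    Literature.Analysis.Asymptotics.eq_zero_of_tendsto_fintypeSum_divergentMonomials_of_le hle hab h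

end Summit.KontsevichZagierPeriods.ValuedFieldSpecialisation
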